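/-
Copyright (c) 2026 the pub-hodgecm-mathlib formalisation cell (harness21).  Prover seat hodgecm-mathlib-K2Liu-p09 (g0): Track B «K2-LIT»,
#184♮ = hLiu418 = stmt-HodgeConjecture-24832, file #9 of the K2_Liu road, organ (III-b) step E5′a (ring-level core); 2026-09-03.
-/
import Literature.NumberTheory.GelbartRogawski1991.DoubledUnitaryAdaptedRelations   -- ★ `adapt`, `blkA…D`, `rel₁₂`, `rel₂₁`, converse
import Literature.NumberTheory.GelbartRogawski1991.DoubledUnitaryAdaptedIwahori     -- ★ `cstar_blockUpper`
import HarnessLib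

/-!
# Crux `HLiu418`, Track B road `K2_Liu`, unit U3a «SIEGEL EISENSTEIN SERIES», file #9 — helper 10 (organ (III-b), step E5′a, RING LEVEL):
# the Levi part of a Siegel element of `U(σ, T ⊕ −T)` — `P_Δ = M_Δ · N_Δ` in the adapted frame

Cell `hodgecm-mathlib`, crux item hLiu418 = `stmt-HodgeConjecture-24832`; squad K2 ∕ K2Liu, prover K2Liu-p09 (g0).  THEOREMS ONLY over an
arbitrary commutative ring `L` with `2` invertible and a ring endomorphism `σ` (Mathlib + ★ `AdaptedBlocks`); lane
`--supports stmt-HodgeConjecture-24832` (count-neutral helper: the algebra behind the letters `leviPart ∕ siegelLeviIn ∕ siegelUnipotentIn` of the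
planned DEFS leaf `K2Lit/SiegelDoubledLeviSemidirect` — step E5′a of PLAN-G2 v2 toward socket #15b ∕ #9).

For `M ∈ U(σ, T ⊕ −T)` (`σ(M)ᵀ (T ⊕ −T) M = T ⊕ −T`) in the Siegel parabolic `P_Δ = {blkC = 0}` (adapted blocks ★ `adapt M = R⁻¹ M R =
[[A, B], [0, D]]`, `R = [[1,1],[1,−1]]`, [Kudla1994, §3]; [HarrisKudlaSweet1996, §1 (1.11)]):

* `levi A D := R · [[A, 0], [0, D]] · R⁻¹`, `unip X := R · [[1, X], [0, 1]] · R⁻¹` (written inline, no definition);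
* **`cstar_levi_of_siegel`** — the LEVI PART `R [[A,0],[0,D]] R⁻¹` of a Siegel `M` lies in `U(σ, T ⊕ −T)` (★ `rel₁₂`, `rel₂₁`: `Aᴴ T D = T = Dᴴ T A`
  at `C = 0`; ★ `cstar_blockUpper`; converse ★ `cstar_mul_diag_mul_of_conj`);
* **`levi_mul_unip_eq`** — `M = (R [[A,0],[0,D]] R⁻¹) · (R [[1, A⁻¹B],[0,1]] R⁻¹)` when `det A` is a unit (factorisation `P_Δ = M_Δ N_Δ`);
* `cstar_unip_of_siegel` — hence the unipotent part is unitary too (`= levi⁻¹ · M`; stated through its adapted blocks);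
* `adapt_levi`, `adapt_unip`, `blkC_levi`, `blkB_levi`, `blkA_unip`, `blkD_unip`; `levi_mul_levi`, `unip_mul_unip`;
  `levi_conj_unip` — `Λ · unip X · Λ⁻¹ = unip (A X D⁻¹)` (`M_Δ` normalises `N_Δ`).

HONEST LABEL.  Count-neutral helper of the K2_Liu road; it retires nothing by itself: `HC_CM` is proved only modulo the 7 printed
citations (2 remaining named inputs: hLiu418 = `stmt-HodgeConjecture-24832`, h413 = `stmt-HodgeConjecture-24833`) until rung 0 closes.

## References
* [Kudla1994] S. S. Kudla, Israel J. Math. 87 (1994), §3 (Siegel parabolic of the doubled group).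
* [HarrisKudlaSweet1996] M. Harris, S. S. Kudla, W. J. Sweet, J. Amer. Math. Soc. 9 (1996), §1 (1.11)–(1.12) (`P_Δ`, Levi `m(a)`, `n(b)`).
* [Garrett2018] P. Garrett, *Modern Analysis of Automorphic Forms by Example* (2018), §3.10 (`P = N M`, `d(nm) = dn dm / m^{2ρ}`).
-/

set_option autoImplicit false
-- the mandated namespace repeats the single-problem summit's segment (`HodgeConjecture.HodgeConjecture`)
set_option linter.dupNamespace false

open Matrix

namespace Summit.HodgeConjecture.HodgeConjecture.Cruxes.HLiu418.K2LiuSiegelDoubledLeviAlgebra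

open Literature.NumberTheory.GelbartRogawski1991.AdaptedBlocks

variable {L : Type*} [CommRing L] {ι : Type*} [Fintype ι] [DecidableEq ι] [Invertible (2 : L)]

/-! ## §1 Adapted blocks of the Levi and unipotent shapes -/

/-- `adapt (R [[A,0],[0,D]] R⁻¹) = [[A,0],[0,D]]`. [cite: HarrisKudlaSweet1996, §1 (1.11)] -/
theorem adapt_levi (A D : Matrix ι ι L) :
    adapt (cayR L ι * Matrix.fromBlocks A 0 0 D * cayRinv L ι) = Matrix.fromBlocks A 0 0 D :=
  adapt_conj _

/-- `adapt (R [[1,X],[0,1]] R⁻¹) = [[1,X],[0,1]]`. [cite: HarrisKudlaSweet1996, §1 (1.12)] -/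
theorem adapt_unip (X : Matrix ι ι L) :
    adapt (cayR L ι * Matrix.fromBlocks 1 X 0 1 * cayRinv L ι) = Matrix.fromBlocks 1 X 0 1 :=
  adapt_conj _

/-- the adapted blocks of the Levi shape. [cite: HarrisKudlaSweet1996, §1 (1.11)] -/
theorem blk_levi (A D : Matrix ι ι L) :
    blkA (cayR L ι * Matrix.fromBlocks A 0 0 D * cayRinv L ι) = A ∧ blkB (cayR L ι * Matrix.fromBlocks A 0 0 D * cayRinv L ι) = 0 ∧
      blkC (cayR L ι * Matrix.fromBlocks A 0 0 D * cayRinv L ι) = 0 ∧ blkD (cayR L ι * Matrix.fromBlocks A 0 0 D * cayRinv L ι) = D := by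
  have h := adapt_levi (L := L) A D
  rw [adapt_eq] at h
  obtain ⟨h₁, h₂, h₃, h₄⟩ := Matrix.fromBlocks_inj.1 h
  exact ⟨h₁, h₂, h₃, h₄⟩

/-- the adapted blocks of the unipotent shape. [cite: HarrisKudlaSweet1996, §1 (1.12)] -/
theorem blk_unip (X : Matrix ι ι L) :
    blkA (cayR L ι * Matrix.fromBlocks 1 X 0 1 * cayRinv L ι) = 1 ∧ blkB (cayR L ι * Matrix.fromBlocks 1 X 0 1 * cayRinv L ι) = X ∧
      blkC (cayR L ι * Matrix.fromBlocks 1 X 0 1 * cayRinv L ι) = 0 ∧ blkD (cayR L ι * Matrix.fromBlocks 1 X 0 1 * cayRinv L ι) = 1 := by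
  have h := adapt_unip (L := L) X
  rw [adapt_eq] at h
  obtain ⟨h₁, h₂, h₃, h₄⟩ := Matrix.fromBlocks_inj.1 h
  exact ⟨h₁, h₂, h₃, h₄⟩

/-- A matrix is determined by its adapted blocks: `M = R (adapt M) R⁻¹`; on the Siegel parabolic `adapt M = [[A,B],[0,D]]`.
[cite: Kudla1994, §3] -/
theorem eq_conj_fromBlocks_of_blkC_eq_zero {M : Matrix (ι ⊕ ι) (ι ⊕ ι) L} (hC : blkC M = 0) :
    M = cayR L ι * Matrix.fromBlocks (blkA M) (blkB M) 0 (blkD M) * cayRinv L ι := by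
  conv_lhs => rw [← cayR_mul_adapt_mul_cayRinv M, adapt_eq, hC]

/-! ## §2 Products -/

/-- `levi A D · levi A' D' = levi (A A') (D D')`. [cite: HarrisKudlaSweet1996, §1 (1.11)] -/
theorem levi_mul_levi (A D A' D' : Matrix ι ι L) :
    (cayR L ι * Matrix.fromBlocks A 0 0 D * cayRinv L ι) * (cayR L ι * Matrix.fromBlocks A' 0 0 D' * cayRinv L ι) =
      cayR L ι * Matrix.fromBlocks (A * A') 0 0 (D * D') * cayRinv L ι := by
  apply eq_of_adapt_eq
  rw [adapt_mul, adapt_levi, adapt_levi, adapt_levi, Matrix.fromBlocks_multiply]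
  simp

/-- `unip X · unip X' = unip (X + X')`. [cite: HarrisKudlaSweet1996, §1 (1.12)] -/
theorem unip_mul_unip (X X' : Matrix ι ι L) :
    (cayR L ι * Matrix.fromBlocks 1 X 0 1 * cayRinv L ι) * (cayR L ι * Matrix.fromBlocks 1 X' 0 1 * cayRinv L ι) =
      cayR L ι * Matrix.fromBlocks 1 (X + X') 0 1 * cayRinv L ι := by
  apply eq_of_adapt_eq
  rw [adapt_mul, adapt_unip, adapt_unip, adapt_unip, Matrix.fromBlocks_multiply]
  simp [add_comm]

/-- `levi A D · unip X = R [[A, A X],[0, D]] R⁻¹`. [cite: HarrisKudlaSweet1996, §1 (1.11)–(1.12)] -/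
theorem levi_mul_unip (A D X : Matrix ι ι L) :
    (cayR L ι * Matrix.fromBlocks A 0 0 D * cayRinv L ι) * (cayR L ι * Matrix.fromBlocks 1 X 0 1 * cayRinv L ι) =
      cayR L ι * Matrix.fromBlocks A (A * X) 0 D * cayRinv L ι := by
  apply eq_of_adapt_eq
  rw [adapt_mul, adapt_levi, adapt_unip, adapt_conj, Matrix.fromBlocks_multiply]
  simp

/-- **Factorisation `P_Δ = M_Δ · N_Δ`**: a Siegel matrix (`blkC M = 0`) with `det (blkA M)` a unit is `levi(A, D) · unip(A⁻¹ B)`.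
[cite: HarrisKudlaSweet1996, §1 (1.11)–(1.12)] [cite: Garrett2018, §3.10] -/
theorem levi_mul_unip_eq {M : Matrix (ι ⊕ ι) (ι ⊕ ι) L} (hC : blkC M = 0) (hA : IsUnit (blkA M).det) :
    (cayR L ι * Matrix.fromBlocks (blkA M) 0 0 (blkD M) * cayRinv L ι) *
        (cayR L ι * Matrix.fromBlocks 1 ((blkA M)⁻¹ * blkB M) 0 1 * cayRinv L ι) = M := by
  rw [levi_mul_unip, ← Matrix.mul_assoc, Matrix.mul_nonsing_inv _ hA, Matrix.one_mul]
  exact (eq_conj_fromBlocks_of_blkC_eq_zero hC).symm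

/-- **`M_Δ` normalises `N_Δ`**: `levi(A,D) · unip X · levi(A⁻¹, D⁻¹) = unip (A X D⁻¹)` for `det A`, `det D` units.
[cite: HarrisKudlaSweet1996, §1 (1.11)–(1.12)] -/
theorem levi_conj_unip (A D X : Matrix ι ι L) (hA : IsUnit A.det) (hD : IsUnit D.det) :
    (cayR L ι * Matrix.fromBlocks A 0 0 D * cayRinv L ι) * (cayR L ι * Matrix.fromBlocks 1 X 0 1 * cayRinv L ι) *
        (cayR L ι * Matrix.fromBlocks A⁻¹ 0 0 D⁻¹ * cayRinv L ι) =
      cayR L ι * Matrix.fromBlocks 1 (A * X * D⁻¹) 0 1 * cayRinv L ι := by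
  apply eq_of_adapt_eq
  rw [adapt_mul, adapt_mul, adapt_levi, adapt_unip, adapt_levi, adapt_unip, Matrix.fromBlocks_multiply,
    Matrix.fromBlocks_multiply]
  simp [Matrix.mul_nonsing_inv _ hA, Matrix.mul_nonsing_inv _ hD, Matrix.mul_assoc]

/-! ## §3 Unitarity of the Levi and unipotent parts -/

variable (σ : L →+* L) (T : Matrix ι ι L)

/-- **The Levi part of a Siegel element of `U(σ, T ⊕ −T)` lies in `U(σ, T ⊕ −T)`**: with `adapt M = [[A,B],[0,D]]`, the unitarity
relations ★ `rel₁₂`, `rel₂₁` at `C = 0` read `Aᴴ T D = T = Dᴴ T A`, which is exactly the unitarity of `[[A,0],[0,D]]` for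
`antidiag(2T, 2T)` (★ `cstar_blockUpper`), i.e. of `R [[A,0],[0,D]] R⁻¹` for `T ⊕ −T` (★ `cstar_mul_diag_mul_of_conj`).
[cite: HarrisKudlaSweet1996, §1 (1.11)] [cite: Garrett2018, §3.10] -/
theorem cstar_levi_of_siegel {M : Matrix (ι ⊕ ι) (ι ⊕ ι) L}
    (hM : (M.map σ)ᵀ * Matrix.fromBlocks T 0 0 (-T) * M = Matrix.fromBlocks T 0 0 (-T)) (hC : blkC M = 0) :
    ((cayR L ι * Matrix.fromBlocks (blkA M) 0 0 (blkD M) * cayRinv L ι).map σ)ᵀ * Matrix.fromBlocks T 0 0 (-T) *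
        (cayR L ι * Matrix.fromBlocks (blkA M) 0 0 (blkD M) * cayRinv L ι) = Matrix.fromBlocks T 0 0 (-T) := by
  have h12 := rel₁₂ (σ := σ) (T := T) hM
  have h21 := rel₂₁ (σ := σ) (T := T) hM
  rw [hC, Matrix.map_zero _ (map_zero σ), Matrix.transpose_zero, Matrix.zero_mul, Matrix.zero_mul, zero_add] at h12
  rw [hC, Matrix.mul_zero, add_zero] at h21
  refine cstar_mul_diag_mul_of_conj (σ := σ) (T := T) ?_
  rw [cstar_blockUpper σ ((2 : L) • T) (blkA M) 0 (blkD M)]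
  simp only [Matrix.mul_smul, Matrix.smul_mul, h12, h21, Matrix.mul_zero, Matrix.map_zero _ (map_zero σ),
    Matrix.transpose_zero, Matrix.zero_mul, smul_zero, add_zero]

/-- The unipotent shape `R [[1,X],[0,1]] R⁻¹` lies in `U(σ, T ⊕ −T)` iff `Xᴴ T + T X = 0` — here the «if» direction.
[cite: HarrisKudlaSweet1996, §1 (1.12)] -/
theorem cstar_unip_of_skew {X : Matrix ι ι L} (hX : (X.map σ)ᵀ * T + T * X = 0) :
    ((cayR L ι * Matrix.fromBlocks 1 X 0 1 * cayRinv L ι).map σ)ᵀ * Matrix.fromBlocks T 0 0 (-T) *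
        (cayR L ι * Matrix.fromBlocks 1 X 0 1 * cayRinv L ι) = Matrix.fromBlocks T 0 0 (-T) := by
  refine cstar_mul_diag_mul_of_conj (σ := σ) (T := T) ?_
  rw [cstar_blockUpper σ ((2 : L) • T) 1 X 1]
  have h2 : ((X.map σ)ᵀ * ((2 : L) • T) + ((2 : L) • T) * X) = 0 := by
    rw [Matrix.mul_smul, Matrix.smul_mul, ← smul_add, hX, smul_zero]
  simp only [Matrix.map_one σ (map_zero σ) (map_one σ), Matrix.transpose_one, Matrix.one_mul, Matrix.mul_one]
  rw [add_comm] at h2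
  rw [show ((2 : L) • T) * X + (X.map σ)ᵀ * ((2 : L) • T) = 0 from h2]

/-- **The unipotent part of a Siegel element of `U(σ, T ⊕ −T)` is unitary**: for `M` unitary with `blkC M = 0` and `det (blkA M)` a unit,
`X := A⁻¹ B` satisfies `Xᴴ T + T X = 0` (from ★ `rel₂₂`: `Dᴴ T B + Bᴴ T D = 0` and `D = T⁻¹ (Aᴴ)⁻¹ T`… — proved here directly from the
factorisation: `unip X = levi⁻¹ · M` is a product of unitary matrices). [cite: HarrisKudlaSweet1996, §1 (1.11)–(1.12)] -/
theorem cstar_unip_of_siegel {M : Matrix (ι ⊕ ι) (ι ⊕ ι) L}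
    (hM : (M.map σ)ᵀ * Matrix.fromBlocks T 0 0 (-T) * M = Matrix.fromBlocks T 0 0 (-T)) (hC : blkC M = 0)
    (hA : IsUnit (blkA M).det) (hD : IsUnit (blkD M).det) :
    ((cayR L ι * Matrix.fromBlocks 1 ((blkA M)⁻¹ * blkB M) 0 1 * cayRinv L ι).map σ)ᵀ * Matrix.fromBlocks T 0 0 (-T) *
        (cayR L ι * Matrix.fromBlocks 1 ((blkA M)⁻¹ * blkB M) 0 1 * cayRinv L ι) = Matrix.fromBlocks T 0 0 (-T) := by
  -- `unip = levi(A⁻¹, D⁻¹) · M`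
  have hfac := levi_mul_unip_eq (L := L) hC hA
  have hinv : (cayR L ι * Matrix.fromBlocks (blkA M)⁻¹ 0 0 (blkD M)⁻¹ * cayRinv L ι) *
      (cayR L ι * Matrix.fromBlocks (blkA M) 0 0 (blkD M) * cayRinv L ι) = 1 := by
    rw [levi_mul_levi, Matrix.nonsing_inv_mul _ hA, Matrix.nonsing_inv_mul _ hD]
    apply eq_of_adapt_eq
    rw [adapt_levi, adapt_one, Matrix.fromBlocks_one]
  have hU : cayR L ι * Matrix.fromBlocks 1 ((blkA M)⁻¹ * blkB M) 0 1 * cayRinv L ι =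
      (cayR L ι * Matrix.fromBlocks (blkA M)⁻¹ 0 0 (blkD M)⁻¹ * cayRinv L ι) * M := by
    have h1 : (cayR L ι * Matrix.fromBlocks (blkA M)⁻¹ 0 0 (blkD M)⁻¹ * cayRinv L ι) *
        ((cayR L ι * Matrix.fromBlocks (blkA M) 0 0 (blkD M) * cayRinv L ι) *
          (cayR L ι * Matrix.fromBlocks 1 ((blkA M)⁻¹ * blkB M) 0 1 * cayRinv L ι)) =
        cayR L ι * Matrix.fromBlocks 1 ((blkA M)⁻¹ * blkB M) 0 1 * cayRinv L ι := by
      rw [← Matrix.mul_assoc, hinv, Matrix.one_mul]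
    rw [hfac] at h1
    exact h1.symm
  -- the Levi inverse is unitary (Levi part of the unitary `M⁻¹`-free argument: apply `cstar_levi_of_siegel`-style check directly)
  have h12 := rel₁₂ (σ := σ) (T := T) hM
  have h21 := rel₂₁ (σ := σ) (T := T) hM
  rw [hC, Matrix.map_zero _ (map_zero σ), Matrix.transpose_zero, Matrix.zero_mul, Matrix.zero_mul, zero_add] at h12
  rw [hC, Matrix.mul_zero, add_zero] at h21
  -- `(A⁻¹)ᴴ T D⁻¹ = T` and `(D⁻¹)ᴴ T A⁻¹ = T` from `Aᴴ T D = T`, `Dᴴ T A = T`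
  have hAi : (blkA M)⁻¹ * blkA M = 1 := Matrix.nonsing_inv_mul _ hA
  have hDi : (blkD M)⁻¹ * blkD M = 1 := Matrix.nonsing_inv_mul _ hD
  have hAi' : blkA M * (blkA M)⁻¹ = 1 := Matrix.mul_nonsing_inv _ hA
  have hDi' : blkD M * (blkD M)⁻¹ = 1 := Matrix.mul_nonsing_inv _ hD
  have hσA : ((blkA M)⁻¹.map σ)ᵀ * ((blkA M).map σ)ᵀ = 1 := by
    rw [← Matrix.transpose_mul, ← Matrix.map_mul, hAi', Matrix.map_one σ (map_zero σ) (map_one σ), Matrix.transpose_one]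
  have hσD : ((blkD M)⁻¹.map σ)ᵀ * ((blkD M).map σ)ᵀ = 1 := by
    rw [← Matrix.transpose_mul, ← Matrix.map_mul, hDi', Matrix.map_one σ (map_zero σ) (map_one σ), Matrix.transpose_one]
  have k12 : ((blkA M)⁻¹.map σ)ᵀ * T * (blkD M)⁻¹ = T := by
    calc ((blkA M)⁻¹.map σ)ᵀ * T * (blkD M)⁻¹
        = ((blkA M)⁻¹.map σ)ᵀ * (((blkA M).map σ)ᵀ * T * blkD M) * (blkD M)⁻¹ := by rw [h12]
      _ = (((blkA M)⁻¹.map σ)ᵀ * ((blkA M).map σ)ᵀ) * T * (blkD M * (blkD M)⁻¹) := by simp only [Matrix.mul_assoc]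
      _ = T := by rw [hσA, hDi', Matrix.one_mul, Matrix.mul_one]
  have k21 : ((blkD M)⁻¹.map σ)ᵀ * T * (blkA M)⁻¹ = T := by
    calc ((blkD M)⁻¹.map σ)ᵀ * T * (blkA M)⁻¹
        = ((blkD M)⁻¹.map σ)ᵀ * (((blkD M).map σ)ᵀ * T * blkA M) * (blkA M)⁻¹ := by rw [h21]
      _ = (((blkD M)⁻¹.map σ)ᵀ * ((blkD M).map σ)ᵀ) * T * (blkA M * (blkA M)⁻¹) := by simp only [Matrix.mul_assoc]
      _ = T := by rw [hσD, hAi', Matrix.one_mul, Matrix.mul_one]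
  have hLinv : ((cayR L ι * Matrix.fromBlocks (blkA M)⁻¹ 0 0 (blkD M)⁻¹ * cayRinv L ι).map σ)ᵀ * Matrix.fromBlocks T 0 0 (-T) *
      (cayR L ι * Matrix.fromBlocks (blkA M)⁻¹ 0 0 (blkD M)⁻¹ * cayRinv L ι) = Matrix.fromBlocks T 0 0 (-T) := by
    refine cstar_mul_diag_mul_of_conj (σ := σ) (T := T) ?_
    rw [cstar_blockUpper σ ((2 : L) • T) ((blkA M)⁻¹) 0 ((blkD M)⁻¹)]
    simp only [Matrix.mul_smul, Matrix.smul_mul, k12, k21, Matrix.mul_zero, Matrix.map_zero _ (map_zero σ),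
      Matrix.transpose_zero, Matrix.zero_mul, smul_zero, add_zero]
  -- product of unitary matrices is unitary
  rw [hU, Matrix.map_mul, Matrix.transpose_mul]
  calc (M.map σ)ᵀ * ((cayR L ι * Matrix.fromBlocks (blkA M)⁻¹ 0 0 (blkD M)⁻¹ * cayRinv L ι).map σ)ᵀ *
        Matrix.fromBlocks T 0 0 (-T) * ((cayR L ι * Matrix.fromBlocks (blkA M)⁻¹ 0 0 (blkD M)⁻¹ * cayRinv L ι) * M)
      = (M.map σ)ᵀ * (((cayR L ι * Matrix.fromBlocks (blkA M)⁻¹ 0 0 (blkD M)⁻¹ * cayRinv L ι).map σ)ᵀ *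
          Matrix.fromBlocks T 0 0 (-T) * (cayR L ι * Matrix.fromBlocks (blkA M)⁻¹ 0 0 (blkD M)⁻¹ * cayRinv L ι)) * M := by
        simp only [Matrix.mul_assoc]
    _ = Matrix.fromBlocks T 0 0 (-T) := by rw [hLinv, hM]

end Summit.HodgeConjecture.HodgeConjecture.Cruxes.HLiu418.K2LiuSiegelDoubledLeviAlgebra
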